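import Mathlib.RepresentationTheory.Homological.GroupCohomology.LongExactSequence
import HarnessLib

/-!
# The kernel of `Hⁿ(G, A) → Hⁿ(G, B)` is torsion in low degrees

Topic `Algebra/Homology`; namespace `Literature.Algebra.Homology`; theorems only (Mathlib's
`groupCohomology`, its long exact sequence and its low-degree models `H0`, `H1`).

For a short exact sequence of representations `0 → A → B → D → 0` over a commutative ring `k` and
`ϖ ∈ k` such that every element of `D` is killed by a power of `ϖ` (the situation of a LATTICE
`A = V_𝒪` in `B = V_E = V_𝒪[1/ϖ]`, `D = V_E/V_𝒪 ≅ (E/𝒪)^d`):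

* `exists_pow_smul_eq_zero_of_map_eq_zero` — the kernel of `Hʲ(G, A) → Hʲ(G, B)` consists of
  `ϖ`-power-torsion classes as soon as every class of `Hⁱ(G, D)` (`i + 1 = j`) is `ϖ`-power torsion
  (long exact sequence, [Brown1982CohomologyGroups, III.6 Prop. 6.1]);
* `H0_exists_pow_smul_eq_zero` — every class of `H⁰(G, D) = Dᴳ` is `ϖ`-power torsion;
* `H1_exists_pow_smul_eq_zero` — every class of `H¹(G, D)` is `ϖ`-power torsion **when `G` is
  finitely generated** (a `1`-cocycle is determined by its values on generators,
  [Brown1982CohomologyGroups, III.1 Ex. 2 / IV.2]); this fails in general (e.g. `G = ℚ`,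
  `Hom(ℚ, ℚ_p/ℤ_p)` is not torsion);
* hence `exists_pow_smul_eq_zero_of_map_one_eq_zero`, `exists_pow_smul_eq_zero_of_map_two_eq_zero`:
  **`ker (H¹(G, A) → H¹(G, B))` is `ϖ`-power torsion, and so is `ker (H²(G, A) → H²(G, B))` for
  finitely generated `G`** — the comparison "`H^q(Γ, V_𝒪) ⊗ E ↪ H^q(Γ, V_E)` on the torsion-free
  quotient" in degrees `q ≤ 2` used for arithmetic groups (where `Γ` is finitely generated), e.g. in
  Hida theory ([Hida1994AIF, §3]).

## References

* K. S. Brown, *Cohomology of Groups*, GTM 87 (1982), III.6 Prop. 6.1 (long exact sequence),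
  III.1 (low-degree cocycles) (held). [Brown1982CohomologyGroups]
* H. Hida, *p-adic ordinary Hecke algebras for GL(2)*, Ann. Inst. Fourier 44 (1994), §3 (held).
  [Hida1994AIF]
-/

noncomputable section

open CategoryTheory groupCohomology

namespace Literature.Algebra.Homology

universe u

variable {k G : Type u} [CommRing k] [Group G] (ϖ : k)

/-! ### From the long exact sequence -/

/-- **The kernel of `Hʲ(G, A) → Hʲ(G, B)` is `ϖ`-power torsion when `Hⁱ(G, B/A)` is** (`i + 1 = j`):
a class mapping to `0` comes from `Hⁱ(G, D)` by the long exact sequence, and the connecting map is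
linear. [cite: Brown1982CohomologyGroups, III.6 Prop. 6.1] -/
theorem exists_pow_smul_eq_zero_of_map_eq_zero {X : ShortComplex (Rep k G)} (hX : X.ShortExact)
    {i j : ℕ} (hij : i + 1 = j) (h₃ : ∀ y : groupCohomology X.X₃ i, ∃ N : ℕ, ϖ ^ N • y = 0)
    (x : groupCohomology X.X₁ j) (hx : map (MonoidHom.id G) X.f j x = 0) :
    ∃ N : ℕ, ϖ ^ N • x = 0 := by
  have hex := (ShortComplex.moduleCat_exact_iff _).1 (mapShortComplex₁_exact hX hij)
  obtain ⟨y, hy⟩ := hex x hx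
  obtain ⟨N, hN⟩ := h₃ y
  refine ⟨N, ?_⟩
  have hy' : (δ hX i j hij).hom y = x := hy
  rw [← hy', ← map_smul, hN, map_zero]

/-! ### Degree `0`: invariants of a torsion module are torsion -/

/-- **Every class of `H⁰(G, D) = Dᴳ` is `ϖ`-power torsion when every element of `D` is.**
[folklore] -/
theorem H0_exists_pow_smul_eq_zero (D : Rep k G) (hD : ∀ d : D.V, ∃ N : ℕ, ϖ ^ N • d = 0)
    (x : groupCohomology D 0) : ∃ N : ℕ, ϖ ^ N • x = 0 := by
  induction x using H0_induction_on with
  | h v =>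
    obtain ⟨N, hN⟩ := hD (v : D.V)
    refine ⟨N, ?_⟩
    have hv : ϖ ^ N • v = 0 := Subtype.ext (by simpa using hN)
    rw [← map_smul, hv, map_zero]

/-! ### Degree `1`: cocycles on a finitely generated group -/

/-- A `1`-cocycle killed by `c` on a generating set is killed by `c`. [cite: Brown1982CohomologyGroups, III.1] -/
theorem smul_cocycles₁_eq_zero_of_forall_mem {D : Rep k G} (c : k) (f : cocycles₁ D) {S : Set G}
    (hS : Subgroup.closure S = ⊤) (hf : ∀ g ∈ S, c • f g = 0) : c • f = 0 := by
  have hall : ∀ g : G, c • f g = 0 := by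
    intro g
    have hg : g ∈ Subgroup.closure S := by
      rw [hS]
      exact Subgroup.mem_top g
    induction hg using Subgroup.closure_induction with
    | mem g hg => exact hf g hg
    | one => rw [cocycles₁_map_one, smul_zero]
    | mul g h _ _ ihg ihh =>
      rw [(mem_cocycles₁_iff f).1 f.2, smul_add, ← LinearMap.map_smul, ihh, map_zero, zero_add, ihg]
    | inv g _ ih =>
      have h1 : f g⁻¹ = -(D.ρ g⁻¹ (f g)) := by
        have h := (mem_cocycles₁_iff f).1 f.2 g⁻¹ g
        rw [inv_mul_cancel, cocycles₁_map_one] at h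
        exact eq_neg_of_add_eq_zero_right h.symm
      rw [h1, smul_neg, ← LinearMap.map_smul, ih, map_zero, neg_zero]
  refine cocycles₁_ext fun g => ?_
  change (c • f).1 g = (0 : cocycles₁ D).1 g
  rw [Submodule.coe_smul, Pi.smul_apply, Submodule.coe_zero, Pi.zero_apply]
  exact hall g

/-- **Every class of `H¹(G, D)` is `ϖ`-power torsion when every element of `D` is and `G` is
finitely generated.** (False without finite generation: `Hom(ℚ, ℚ_p/ℤ_p)` is not torsion.)
[cite: Brown1982CohomologyGroups, III.1] -/
theorem H1_exists_pow_smul_eq_zero (D : Rep k G) (hD : ∀ d : D.V, ∃ N : ℕ, ϖ ^ N • d = 0)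
    {S : Set G} (hS : Subgroup.closure S = ⊤) (hSf : S.Finite) (x : groupCohomology D 1) :
    ∃ N : ℕ, ϖ ^ N • x = 0 := by
  classical
  induction x using H1_induction_on with
  | h f =>
    choose N hN using hD
    refine ⟨hSf.toFinset.sup fun g => N (f g), ?_⟩
    have hf : (ϖ ^ hSf.toFinset.sup fun g => N (f g)) • f = 0 := by
      refine smul_cocycles₁_eq_zero_of_forall_mem _ f hS fun g hg => ?_
      have hle : N (f g) ≤ hSf.toFinset.sup fun g => N (f g) :=
        Finset.le_sup (f := fun g => N (f g)) (hSf.mem_toFinset.2 hg)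
      rw [← Nat.sub_add_cancel hle, pow_add, mul_smul, hN, smul_zero]
    rw [← map_smul, hf, map_zero]

/-! ### The kernels in degrees `1` and `2` -/

/-- **`ker (H¹(G, A) → H¹(G, B))` is `ϖ`-power torsion** when every element of `B/A` is killed by
a power of `ϖ`. [cite: Brown1982CohomologyGroups, III.6 Prop. 6.1] -/
theorem exists_pow_smul_eq_zero_of_map_one_eq_zero {X : ShortComplex (Rep k G)}
    (hX : X.ShortExact) (h₃ : ∀ d : X.X₃.V, ∃ N : ℕ, ϖ ^ N • d = 0)
    (x : groupCohomology X.X₁ 1) (hx : map (MonoidHom.id G) X.f 1 x = 0) :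
    ∃ N : ℕ, ϖ ^ N • x = 0 :=
  exists_pow_smul_eq_zero_of_map_eq_zero ϖ hX (zero_add 1) (H0_exists_pow_smul_eq_zero ϖ X.X₃ h₃)
    x hx

/-- **`ker (H²(G, A) → H²(G, B))` is `ϖ`-power torsion for finitely generated `G`** when every
element of `B/A` is killed by a power of `ϖ`. [cite: Brown1982CohomologyGroups, III.6 Prop. 6.1, III.1]
[cite: Hida1994AIF, §3] -/
theorem exists_pow_smul_eq_zero_of_map_two_eq_zero {X : ShortComplex (Rep k G)}
    (hX : X.ShortExact) (h₃ : ∀ d : X.X₃.V, ∃ N : ℕ, ϖ ^ N • d = 0) {S : Set G}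
    (hS : Subgroup.closure S = ⊤) (hSf : S.Finite)
    (x : groupCohomology X.X₁ 2) (hx : map (MonoidHom.id G) X.f 2 x = 0) :
    ∃ N : ℕ, ϖ ^ N • x = 0 :=
  exists_pow_smul_eq_zero_of_map_eq_zero ϖ hX (by norm_num)
    (H1_exists_pow_smul_eq_zero ϖ X.X₃ h₃ hS hSf) x hx

end Literature.Algebra.Homology
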